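import Literature.AnabelianGeometry.SemiGraphs.ApproximatorBridge
import Literature.AnabelianGeometry.SemiGraphs.ProfiniteHomToAnab
import Literature.AnabelianGeometry.Anabelioids.BCatBranchConjugacy
import HarnessLib

/-!
# [SemiAnbd] §2/§3: a §3 approximator is a §2 approximator (Def. 2.3 (ii) p. 25) — proofs

Mochizuki, *Semi-graphs of anabelioids*, Publ. RIMS **42** (2006), Def. 2.3 (i)–(ii) pp. 24–25
[cite: MochizukiSemiAnbd2006, Def 2.3(ii) p.25].  For an approximator `A` of a profinite
presentation `𝒢` (`ProfiniteSemiGraph.Approximator`), the §2 morphism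
`A.toHom.toAnab : 𝒢.toAnab ⟶ A.toProfinite.toAnab` (`ApproximatorBridge.lean`,
`ProfiniteHomToAnab.lean`) IS an approximator in the sense of `Commensurability.lean`
(`toAnab_isApproximator`: identity on the underlying semi-graph; target of bounded order — at EVERY
basepoint `π₁(B(F_v), β) ≃ F_v` is finite of order dividing `M`), and it is `π₁`-epimorphic when
`A` is (`toAnab_isPi1EpiApproximator`), because `B(φ)` is a `π₁`-epimorphism iff `φ` is surjective
(`isPi1Epi_res_iff_surjective`, via `π₁(B(G)) = G`).  Proof-only file.
-/

noncomputable section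

namespace Literature.AnabelianGeometry.Anabelioids

open CategoryTheory CategoryTheory.Limits CategoryTheory.PreGaloisCategory
open Literature.AlgebraicGeometry.Frobenioids (BCat)
open scoped FintypeCatDiscrete

universe u

/-- **`B(φ)` is a `π₁`-epimorphism iff `φ` is surjective** (profinite `G`, `H`): under
`π₁(B(H)) = H`, `π₁(B(G)) = G`, `π₁(res φ)` is `φ`. [cite: MochizukiGeoAn2004, Def. 1.1.2(ii) p.10] -/
theorem isPi1Epi_res_iff_surjective {G H : Type u} [Group G] [TopologicalSpace G]
    [IsTopologicalGroup G] [CompactSpace G] [TotallyDisconnectedSpace G] [Group H]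
    [TopologicalSpace H] [IsTopologicalGroup H] [CompactSpace H] [TotallyDisconnectedSpace H]
    (φ : H →ₜ* G) :
    (letI := galoisCategory_bCat G; letI := galoisCategory_bCat H;
      IsPi1Epi (ContAction.res FintypeCat.{u} φ)) ↔ Function.Surjective φ := by
  letI := galoisCategory_bCat G
  letI := galoisCategory_bCat H
  haveI := fiberFunctor_forget_bCat H
  obtain ⟨eG, heG⟩ := exists_continuousMulEquiv_aut_forget (G := G)
  obtain ⟨eH, heH⟩ := exists_continuousMulEquiv_aut_forget (G := H)
  rw [isPi1Epi_iff_surjective (ContAction.res FintypeCat.{u} φ)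
    (ObjectProperty.ι (Action.IsContinuous (V := FintypeCat.{u}) (G := H)) ⋙
      Action.forget FintypeCat.{u} H)]
  -- components of `π₁(res φ)(e_H h)` are `ρ_X(φ h)`
  have happ : ∀ (h : H) (X : BCat G),
      (pi1Map (ContAction.res FintypeCat.{u} φ)
        (ObjectProperty.ι (Action.IsContinuous (V := FintypeCat.{u}) (G := H)) ⋙
          Action.forget FintypeCat.{u} H) (eH h)).hom.app X = X.obj.ρ (φ h) :=
    fun h X => pi1Map_res_app φ (eH h) h (heH h) X
  constructor
  · intro hsurj g
    -- the automorphism "act by g", viewed on `res φ ⋙ forget_H = forget_G`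
    obtain ⟨σ, hσ⟩ := hsurj (pi1Map (𝟭 (BCat G))
      (ObjectProperty.ι (Action.IsContinuous (V := FintypeCat.{u}) (G := G)) ⋙
        Action.forget FintypeCat.{u} G) (eG g))
    obtain ⟨h, rfl⟩ := eH.surjective σ
    refine ⟨h, eG.injective (aut_forget_eq_of_app_eq _ _ fun X => ?_)⟩
    rw [heG, ← happ h X, hσ]
    rfl
  · intro hsurj σ'
    -- `σ'` acts on every `X : B(G)`; it is `act by g` for some `g`, and `g = φ h`
    let τ : Aut (ObjectProperty.ι (Action.IsContinuous (V := FintypeCat.{u}) (G := G)) ⋙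
        Action.forget FintypeCat.{u} G) := pi1Map (𝟭 (BCat G)) _ σ'
    obtain ⟨g, hg⟩ := eG.surjective τ
    obtain ⟨h, rfl⟩ := hsurj g
    refine ⟨eH h, ?_⟩
    apply Iso.ext
    apply NatTrans.ext
    funext X
    rw [happ, ← heG]
    have := congrArg (fun ν : Aut (ObjectProperty.ι (Action.IsContinuous (V := FintypeCat.{u})
      (G := G)) ⋙ Action.forget FintypeCat.{u} G) => ν.hom.app X) hg
    exact this

end Literature.AnabelianGeometry.Anabelioids

namespace Literature.AnabelianGeometry.SemiGraphs

open CategoryTheory CategoryTheory.Limits CategoryTheory.PreGaloisCategory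
open Literature.AnabelianGeometry.Anabelioids
open Literature.AlgebraicGeometry.Frobenioids (BCat)
open scoped FintypeCatDiscrete

universe u

namespace ProfiniteSemiGraph

namespace Approximator

variable {𝒢 : ProfiniteSemiGraph.{u}} (A : 𝒢.Approximator)

/-- `𝒢'` is of injective type (§2 sense). [cite: MochizukiSemiAnbd2006, Def 2.3(ii) p.25] -/
theorem toProfinite_toAnab_isOfInjectiveType : A.toProfinite.toAnab.IsOfInjectiveType :=
  (A.toProfinite.isOfInjectiveType_toAnab_iff).mpr fun b v h => A.brF_injective b v h

/-- `𝒢'` is of bounded order (§2 sense): at EVERY basepoint of `B(F_v)`, `π₁ ≃ F_v` is finite of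
order dividing the bound of `A`. [cite: MochizukiSemiAnbd2006, Def 2.3(i) p.24] -/
theorem toProfinite_toAnab_isOfBoundedOrder : A.toProfinite.toAnab.IsOfBoundedOrder := by
  refine ⟨A.toProfinite_toAnab_isOfInjectiveType, ?_⟩
  obtain ⟨M, hM, hdvd⟩ := A.bounded
  refine ⟨M, hM, fun v F hF => ?_⟩
  obtain ⟨θ, -⟩ := @exists_mulEquiv_forall_range_conj (A.toProfinite.Gv v) _ _
    (A.toProfinite.isTopologicalGroupV v) (A.toProfinite.compactSpaceV v)
    (A.toProfinite.totallyDisconnectedSpaceV v) F hF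
  haveI : Finite (A.toProfinite.Gv v) := A.finiteFV v
  refine ⟨Finite.of_equiv _ θ.toEquiv.symm, ?_⟩
  have hc : Nat.card (Aut F) = Nat.card (A.FV v) := Nat.card_congr θ.toEquiv
  rw [hc]
  exact hdvd v

/-- **A §3 approximator is a §2 approximator**: `A.toHom.toAnab` induces the identity on the
underlying semi-graph and its target is of bounded order. [cite: MochizukiSemiAnbd2006, Def 2.3(ii) p.25] -/
theorem toAnab_isApproximator : A.toHom.toAnab.IsApproximator := by
  refine ⟨?_, A.toProfinite_toAnab_isOfBoundedOrder⟩
  change IsIso (𝟙 𝒢.graph)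
  infer_instance

/-- **`π₁`-epimorphic approximators agree**: if the `Π_v → F_v`, `Π_e → F_e` of `A` are
surjective, `A.toHom.toAnab` is a `π₁`-epimorphic approximator in the §2 sense.
[cite: MochizukiSemiAnbd2006, Def 2.3(ii) p.25] -/
theorem toAnab_isPi1EpiApproximator (hA : A.IsPiOneEpimorphic) :
    A.toHom.toAnab.IsPi1EpiApproximator := by
  refine ⟨A.toAnab_isApproximator, fun v => ?_, fun e => ?_⟩
  · exact (@isPi1Epi_res_iff_surjective (A.toProfinite.Gv v) (𝒢.Gv v) _ _
      (A.toProfinite.isTopologicalGroupV v) (A.toProfinite.compactSpaceV v)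
      (A.toProfinite.totallyDisconnectedSpaceV v) _ _ (𝒢.isTopologicalGroupV v)
      (𝒢.compactSpaceV v) (𝒢.totallyDisconnectedSpaceV v) (A.toHom.hV v)).mpr (hA.1 v)
  · exact (@isPi1Epi_res_iff_surjective (A.toProfinite.Ge e) (𝒢.Ge e) _ _
      (A.toProfinite.isTopologicalGroupE e) (A.toProfinite.compactSpaceE e)
      (A.toProfinite.totallyDisconnectedSpaceE e) _ _ (𝒢.isTopologicalGroupE e)
      (𝒢.compactSpaceE e) (𝒢.totallyDisconnectedSpaceE e) (A.toHom.hE e)).mpr (hA.2 e)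

/-- Conversely, a `π₁`-epimorphic `A.toHom.toAnab` has surjective `Π_v → F_v`, `Π_e → F_e`.
[cite: MochizukiSemiAnbd2006, Def 2.3(ii) p.25] -/
theorem isPiOneEpimorphic_of_toAnab (hA : A.toHom.toAnab.IsPi1EpiApproximator) :
    A.IsPiOneEpimorphic := by
  refine ⟨fun v => ?_, fun e => ?_⟩
  · exact (@isPi1Epi_res_iff_surjective (A.toProfinite.Gv v) (𝒢.Gv v) _ _
      (A.toProfinite.isTopologicalGroupV v) (A.toProfinite.compactSpaceV v)
      (A.toProfinite.totallyDisconnectedSpaceV v) _ _ (𝒢.isTopologicalGroupV v)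
      (𝒢.compactSpaceV v) (𝒢.totallyDisconnectedSpaceV v) (A.toHom.hV v)).mp (hA.isPi1Epi_V v)
  · exact (@isPi1Epi_res_iff_surjective (A.toProfinite.Ge e) (𝒢.Ge e) _ _
      (A.toProfinite.isTopologicalGroupE e) (A.toProfinite.compactSpaceE e)
      (A.toProfinite.totallyDisconnectedSpaceE e) _ _ (𝒢.isTopologicalGroupE e)
      (𝒢.compactSpaceE e) (𝒢.totallyDisconnectedSpaceE e) (A.toHom.hE e)).mp (hA.isPi1Epi_E e)

end Approximator

end ProfiniteSemiGraph

end Literature.AnabelianGeometry.SemiGraphs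

end
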